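import Mathlib
import Summits.NavierStokesRegularity.NavierStokesRegularity.Theorems.EulerZoomLiouvillePowerGaugeEulerLiouvilleSelfSimilarKelvinFlowC2
import HarnessLib.Audit

/-!
# Crux E `EulerZoomLiouville.PowerGaugeEulerLiouville` — RESIDENCE CLOCKS ARE MONOTONE IN THE WINDOW:
# a LOG clock `s₁ log R` is already a POWER clock `c′R^{2+ρ}` for every `c′ > 0` (byte diet for `HasResidenceClock`)

Route №10 `EulerZoomLiouville` (NavierStokesRegularity), crux E = stmt-NavierStokesRegularity-19832, line `birth`, registered
residue `stub_selfSimilarC2Needle` and its binder `¬ HasResidenceClock ρ V` (LEAD ns-typeII-p2 g12, skeleton v68–v70: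
`HasResidenceClock` := LOG form (p644129) ∨ POWER form (p645025)); seat ns-ezl-w5 g3, `--supports stmt-NavierStokesRegularity-19832
--as helper`.

* `NeedleClock.linger_subset_of_window_le` — the lingering set only SHRINKS when the window grows: `t ≤ t′` ⇒
  `{y | ∀ σ ∈ [0,t′], ‖Ψ_σ y‖ ≤ b} ⊆ {y | ∀ σ ∈ [0,t], ‖Ψ_σ y‖ ≤ b}`;
* `NeedleClock.mul_log_le_mul_rpow` — `s₁ log R ≤ c′ R^{2+ρ}` for `R ≥ max 1 (s₁/c′)` (`ρ ≥ 0`, `c′ > 0`, any real `s₁`);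
* **`NeedleClock.powerClock_of_logClock`** — p644129's LOG `hclock` (strength `s₁ log R`, any real `s₁`) implies p645025's POWER
  `hclock` for EVERY `c′ > 0`, for any profile `V` and any `ρ ≥ 0`: pure measure monotonicity, no profile equation.

CONSEQUENCE for the skeleton: `HasResidenceClock ρ V` may be defined as the POWER form alone; the log member
`NeedleRace.selfSimilar_ae_eq_zero_of_logClockC2` (p644129) and every log-clock stratum land in it through this lemma.
NOT NS, not E: bookkeeping for the crux CLASS (MODEL lattice); 19832 OPEN. [folklore]
-/

noncomputable section

-- the summit and its single problem share the name `NavierStokesRegularity` (D-0017 nested layout)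
set_option linter.dupNamespace false

open Set Filter Topology Metric Function MeasureTheory
open scoped NNReal ENNReal

namespace Summit.NavierStokesRegularity.NavierStokesRegularity.Theorems.PowerGaugeEulerLiouville.NeedleClock

open Literature.Analysis Literature.Analysis.FluidPDE

variable {γ : ℝ} {V' : EuclideanSpace ℝ (Fin 3) → EuclideanSpace ℝ (Fin 3)}

/-- **Lingering sets shrink as the window grows**: if `t ≤ t′`, every label lingering in `‖·‖ ≤ b` during `[0, t′]`
lingers during `[0, t]`. [folklore] -/
theorem linger_subset_of_window_le {t t' b : ℝ} (htt' : t ≤ t') :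
    {y : EuclideanSpace ℝ (Fin 3) | ∀ σ ∈ Icc 0 t',
        ‖ODE.evolutionMap (fun _ : ℝ => selfSimilarTransport γ 0 V') 0 (-σ) y‖ ≤ b} ⊆
      {y | ∀ σ ∈ Icc 0 t, ‖ODE.evolutionMap (fun _ : ℝ => selfSimilarTransport γ 0 V') 0 (-σ) y‖ ≤ b} :=
  fun _ hy σ hσ => hy σ ⟨hσ.1, hσ.2.trans htt'⟩

/-- **Log windows fit inside power windows**: for `ρ ≥ 0`, `c′ > 0`, any real `s₁` and `R ≥ max 1 (s₁/c′)`: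
`s₁ log R ≤ c′ R^{2+ρ}` (`0 ≤ log R ≤ R` and `R² ≤ R^{2+ρ}`). [folklore] -/
theorem mul_log_le_mul_rpow {ρ s₁ c' R : ℝ} (hρ : 0 ≤ ρ) (hc' : 0 < c')
    (hR : max 1 (s₁ / c') ≤ R) : s₁ * Real.log R ≤ c' * R ^ (2 + ρ) := by
  have hR1 : 1 ≤ R := le_trans (le_max_left _ _) hR
  have hR0 : 0 < R := by linarith
  have hRs : s₁ / c' ≤ R := le_trans (le_max_right _ _) hR
  have hs₁R : s₁ ≤ c' * R := by rwa [div_le_iff₀' hc'] at hRs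
  have hlog : Real.log R ≤ R := (Real.log_le_sub_one_of_pos hR0).trans (by linarith)
  have hlog0 : 0 ≤ Real.log R := Real.log_nonneg hR1
  have hRR : R * R ≤ R ^ (2 + ρ) := by
    have h2 : R ^ (2 : ℝ) ≤ R ^ (2 + ρ) := Real.rpow_le_rpow_of_exponent_le hR1 (by linarith)
    have e : R ^ (2 : ℝ) = R * R := by rw [Real.rpow_two, sq]
    rwa [e] at h2
  calc s₁ * Real.log R ≤ (c' * R) * R :=
        mul_le_mul hs₁R hlog hlog0 (by positivity)
    _ = c' * (R * R) := by ring
    _ ≤ c' * R ^ (2 + ρ) := mul_le_mul_of_nonneg_left hRR hc'.le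

/-- **A LOG RESIDENCE CLOCK IS A POWER RESIDENCE CLOCK (for every `c′ > 0`).**  For any `ρ ≥ 0` and any profile `V`:
p644129's LOG `hclock` (around every vortical point a ball at most half of whose labels linger in `‖·‖ ≤ 2R` during backward
similarity time `s₁ log R`, all large `R`, every `C²` globally Lipschitz cut-off copy `V′ = V` on `ball 0 R_big ⊋ B̄_{2R}`;
no sign condition on `s₁` is needed) implies p645025's POWER `hclock` VERBATIM for every `c′ > 0` — lingering during the
longer window `c′R^{2+ρ} ≥ s₁ log R` is harder.  Hence `HasResidenceClock ρ V` may be taken to be the power form alone.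
[folklore] -/
theorem powerClock_of_logClock {ρ : ℝ} (hρ : 0 ≤ ρ) {V : EuclideanSpace ℝ (Fin 3) → EuclideanSpace ℝ (Fin 3)}
    {s₁ : ℝ}
    (hclock : ∀ x₀ : EuclideanSpace ℝ (Fin 3), curl V x₀ ≠ 0 → ∃ r : ℝ, 0 < r ∧ ∃ R₀ : ℝ, ∀ R : ℝ, R₀ ≤ R →
      ∀ (V' : EuclideanSpace ℝ (Fin 3) → EuclideanSpace ℝ (Fin 3)) (K Rbig : ℝ), ContDiff ℝ 2 V' →
        (∀ y, ‖fderiv ℝ V' y‖ ≤ K) → 2 * R < Rbig →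
        (∀ w ∈ ball (0 : EuclideanSpace ℝ (Fin 3)) Rbig, V' w = V w) →
        (volume (ball x₀ r ∩ {y | ∀ σ ∈ Icc 0 (s₁ * Real.log R),
          ‖ODE.evolutionMap (fun _ : ℝ => selfSimilarTransport (1 / (2 + ρ)) 0 V') 0 (-σ) y‖ ≤ 2 * R})).toReal ≤
          (volume (ball x₀ r)).toReal / 2) :
    ∀ c' : ℝ, 0 < c' → ∀ x₀ : EuclideanSpace ℝ (Fin 3), curl V x₀ ≠ 0 → ∃ r : ℝ, 0 < r ∧ ∃ R₀ : ℝ,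
      ∀ R : ℝ, R₀ ≤ R → ∀ (V' : EuclideanSpace ℝ (Fin 3) → EuclideanSpace ℝ (Fin 3)) (K Rbig : ℝ), ContDiff ℝ 2 V' →
        (∀ y, ‖fderiv ℝ V' y‖ ≤ K) → 2 * R < Rbig →
        (∀ w ∈ ball (0 : EuclideanSpace ℝ (Fin 3)) Rbig, V' w = V w) →
        (volume (ball x₀ r ∩ {y | ∀ σ ∈ Icc 0 (c' * R ^ (2 + ρ)),
          ‖ODE.evolutionMap (fun _ : ℝ => selfSimilarTransport (1 / (2 + ρ)) 0 V') 0 (-σ) y‖ ≤ 2 * R})).toReal ≤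
          (volume (ball x₀ r)).toReal / 2 := by
  intro c' hc' x₀ hx₀
  obtain ⟨r, hr, R₀, hR₀⟩ := hclock x₀ hx₀
  refine ⟨r, hr, max R₀ (max 1 (s₁ / c')), fun R hR V' K Rbig hV' hK hRbig hVU => ?_⟩
  have hRR₀ : R₀ ≤ R := le_trans (le_max_left _ _) hR
  have hwin : s₁ * Real.log R ≤ c' * R ^ (2 + ρ) :=
    mul_log_le_mul_rpow hρ hc' (le_trans (le_max_right _ _) hR)
  have hsub : ball x₀ r ∩ {y | ∀ σ ∈ Icc 0 (c' * R ^ (2 + ρ)),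
        ‖ODE.evolutionMap (fun _ : ℝ => selfSimilarTransport (1 / (2 + ρ)) 0 V') 0 (-σ) y‖ ≤ 2 * R} ⊆
      ball x₀ r ∩ {y | ∀ σ ∈ Icc 0 (s₁ * Real.log R),
        ‖ODE.evolutionMap (fun _ : ℝ => selfSimilarTransport (1 / (2 + ρ)) 0 V') 0 (-σ) y‖ ≤ 2 * R} :=
    inter_subset_inter_right _ (linger_subset_of_window_le hwin)
  have hfin : volume (ball x₀ r ∩ {y | ∀ σ ∈ Icc 0 (s₁ * Real.log R),
      ‖ODE.evolutionMap (fun _ : ℝ => selfSimilarTransport (1 / (2 + ρ)) 0 V') 0 (-σ) y‖ ≤ 2 * R}) ≠ ⊤ :=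
    (lt_of_le_of_lt (measure_mono inter_subset_left) measure_ball_lt_top).ne
  exact le_trans (ENNReal.toReal_mono hfin (measure_mono hsub)) (hR₀ R hRR₀ V' K Rbig hV' hK hRbig hVU)

end Summit.NavierStokesRegularity.NavierStokesRegularity.Theorems.PowerGaugeEulerLiouville.NeedleClock

end
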